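import Summits.BirchSwinnertonDyer.BirchSwinnertonDyer.Theorems.TwoAdicConverseGoodTwistsLeafOn
import Summits.BirchSwinnertonDyer.BirchSwinnertonDyer.Theorems.TwoAdicConverseTwoTorsionPairTypes
import HarnessLib

/-!
# Route TwoAdicConverse — the S3 head line on a class closed under ADMISSIBLE twists between MINIMAL models, and its
# instances: the three (β)-atoms A₁ / A₂ / A₃ (proofs only)

Cell `bsd-2adic`, seat `bsd-2adic-conv-1` GEN 20 (`--supports` item stmt-BirchSwinnertonDyer-19218; nothing here closes
it).  conv-1 GEN 18's engine `TwoAdicConverseGoodTwistsLeafOn` derives LADDER-BSD row S3's head line (rank BSD for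
`100 %` of the admissible twists `d ≡ 1 (mod 4)` + Goldfeld `50/50`) for every curve of a class `P` from the leaf ON `P`,
but asks `P` to be stable under EVERY model of EVERY twist `d ≠ 0`.  The Greenberg-configuration atoms of stratum (β)
(`TwoAdicConverseTwoTorsionPairTypes`: «ramified at `2`» is read on a `2`-minimal equation, and only odd `d` keep the
reduction type) are stable only in the weaker sense
  `hP : V, V' globally minimal, V good-ordinary or multiplicative at `2`, d ≡ 1 (mod 4), C • V' = V^{(d)} ⟹ P V → P V'`,
which is all the engine ever uses.  This file re-runs the engine under that weaker stability (§1–§2, same proofs) and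
instantiates it (§3) for A₁ «`Δ < 0` ∧ ramified, or unramified middle», A₂ «`Δ < 0` ∧ unramified, or ramified middle»,
A₃ «`Δ > 0` ∧ extreme» (`atom₁/₂/₃_twist`): **if the leaf holds on the atom `Aᵢ`, every `W ∈ Aᵢ` satisfies the S3 head
line** (`bsdRank_and_goldfeld_goodTwists_of_atom₁/₂/₃`).

HONEST FRAMING.  Pure logic + counting already in the tree; the atom-restricted leaf, GZK, Modularity and Smith's
Thm 1.1 are hypotheses; nothing is booked (D-0054); BSD is not proved by any of this.  PARTITION: none — RANK axis (S3)
× the quadratic-twist axis; companion cell X5@2.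

References: A. Smith, arXiv:2503.17619, Thm 1.1 / Cor 1.2 [arXiv250317619]; R. Greenberg, LNM 1716 §5
[GreenbergLNM1716]; M. R. Murty, V. K. Murty, *Non-vanishing of L-functions and applications* (1997) Ch. 6 §1
[MurtyMurty1997]; J. H. Silverman, AEC (2009) X.5 Cor 5.4 [SilvermanAEC2009].
-/

set_option linter.dupNamespace false
set_option autoImplicit false

noncomputable section

open scoped Classical
open Filter Topology WeierstrassCurve Literature Literature.NumberTheory.EllipticCurves
  Literature.NumberTheory.EllipticCurves.ModularForms
  Literature.NumberTheory.EllipticCurves.Rank1Residual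
  Literature.NumberTheory.EllipticCurves.Greenberg1999
  Summit.BirchSwinnertonDyer.BirchSwinnertonDyer.Theses.TwoAdicConverse
  Summit.BirchSwinnertonDyer.BirchSwinnertonDyer.Theorems.GoldfeldGoodTwists
  Summit.BirchSwinnertonDyer.BirchSwinnertonDyer.Theorems.TwoAdicGoodTwists
  Summit.BirchSwinnertonDyer.BirchSwinnertonDyer.Theorems.TwoAdicKolyvaginGoodTwists

namespace Summit.BirchSwinnertonDyer.BirchSwinnertonDyer.Theorems.TwoAdicOffHabitat

/-! ## §1 One admissible twist of a curve in a minimally-twist-closed class -/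

section OneTwist

/-- **Rank BSD for one admissible twist, from the leaf RESTRICTED to a class `P` stable under admissible twists between
MINIMAL models.**  Same statement and proof as `bsdRank_quadraticTwist_of_selmerCorankTwoInfty_le_one_of_leafOn`, with
the stability hypothesis `hP` weakened to globally minimal `V`, `V'`, `V` non-CM and good-ordinary or multiplicative at
`2`, and `d ≡ 1 (mod 4)`. [cite: arXiv250317619, §1 (the p-converse input of Cor. 1.2)] [cite: SilvermanAEC2009, X.5 Cor. 5.4] -/
theorem bsdRank_quadraticTwist_of_selmerCorankTwoInfty_le_one_of_leafOnMinimal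
    (P : WeierstrassCurve ℚ → Prop)
    (hP : ∀ (V V' : WeierstrassCurve ℚ) [V.IsElliptic] [V.IsGloballyMinimal] [V'.IsElliptic]
      [V'.IsGloballyMinimal] {d : ℤ}, d % 4 = 1 → ∀ {C : VariableChange ℚ}, C • V' = V.quadraticTwist (d : ℚ) →
      ¬ V.HasCM → (GoodOrd V 2 ∨ Mult V 2) → P V → P V')
    (hleaf : ∀ (V : WeierstrassCurve ℚ) [V.IsElliptic] [V.IsGloballyMinimal], ¬ V.HasCM →
      (GoodOrd V 2 ∨ Mult V 2) → P V → ∀ r : ℕ, r ≤ 1 → V.selmerCorank 2 = r → V.analyticRank = r)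
    (hGZK : rank_eq_analyticRank_of_analyticRank_le_one)
    (W : WeierstrassCurve ℚ) [W.IsElliptic] [W.IsGloballyMinimal] (hCM : ¬ W.HasCM)
    (hred : GoodOrd W 2 ∨ Mult W 2) (hW : P W)
    {d : ℤ} (hd4 : d % 4 = 1) (hle : selmerCorankTwoInfty (W.quadraticTwist d) ≤ 1) :
    (W.quadraticTwist d).analyticRank = selmerCorankTwoInfty (W.quadraticTwist d) ∧
      (W.quadraticTwist d).mordellWeilRank = selmerCorankTwoInfty (W.quadraticTwist d) ∧
        Finite (W.quadraticTwist d).sha := by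
  have hd0 : ((d : ℤ) : ℚ) ≠ 0 := by exact_mod_cast (show d ≠ 0 by omega)
  haveI := W.isElliptic_quadraticTwist hd0
  obtain ⟨W', hW'ell, hW'min, C, hC⟩ := exists_isGloballyMinimal_smul_eq_quadraticTwist W hd0
  obtain ⟨hCM', hred'⟩ := not_hasCM_and_goodOrd_or_mult_of_smul_eq_quadraticTwist W W' hCM hred hd4 hC
  have hW' : P W' := hP W W' hd4 hC hCM hred hW
  have hcor' : W'.selmerCorank 2 = selmerCorankTwoInfty (W.quadraticTwist d) := by
    rw [selmerCorank_eq_of_variableChange 2 hC, ← selmerCorankTwoInfty_eq]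
  have hW'r : W'.analyticRank = selmerCorankTwoInfty (W.quadraticTwist d) :=
    hleaf W' hCM' hred' hW' _ hle hcor'
  have har : (W.quadraticTwist (d : ℚ)).analyticRank = selmerCorankTwoInfty (W.quadraticTwist d) := by
    rw [← hW'r, ← hC, analyticRank_smul]
  obtain ⟨hrank, hsha⟩ := hGZK (W.quadraticTwist (d : ℚ)) (by omega)
  exact ⟨har, by rw [hrank, har], hsha⟩

end OneTwist

/-! ## §2 The head line for every curve of a minimally-twist-closed class -/

section Density


/-- **For `100 %` of `d ∈ 𝓕`: `ord L = rank = corank Sel_{2^∞} ≤ 1` and `Ш` finite**, for `W` in the class `P`.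
[cite: arXiv250317619, Thm. 1.1 and Cor. 1.2] -/
theorem tendsto_bsdRank_eq_selmerCorankTwoInfty_of_leafOnMinimal
    (P : WeierstrassCurve ℚ → Prop)
    (hPmin : ∀ (V V' : WeierstrassCurve ℚ) [V.IsElliptic] [V.IsGloballyMinimal] [V'.IsElliptic]
      [V'.IsGloballyMinimal] {d : ℤ}, d % 4 = 1 → ∀ {C : VariableChange ℚ}, C • V' = V.quadraticTwist (d : ℚ) →
      ¬ V.HasCM → (GoodOrd V 2 ∨ Mult V 2) → P V → P V')
    (hleaf : ∀ (V : WeierstrassCurve ℚ) [V.IsElliptic] [V.IsGloballyMinimal], ¬ V.HasCM →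
      (GoodOrd V 2 ∨ Mult V 2) → P V → ∀ r : ℕ, r ≤ 1 → V.selmerCorank 2 = r → V.analyticRank = r)
    (hGZK : rank_eq_analyticRank_of_analyticRank_le_one)
    (W : WeierstrassCurve ℚ) [W.IsElliptic] [W.IsGloballyMinimal]
    (hCM : ¬ W.HasCM)
    (hred : GoodOrd W 2 ∨ Mult W 2) (hW : P W) (hS : smith_selmerCorank_density W) :
    Tendsto (fun X : ℕ ↦ (Nat.card {d : ℤ | Squarefree d ∧ |d| ≤ (X : ℤ) ∧ (d % 4 = 1 ∧
        (selmerCorankTwoInfty (W.quadraticTwist d) ≤ 1 ∧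
          (W.quadraticTwist d).analyticRank = selmerCorankTwoInfty (W.quadraticTwist d) ∧
          (W.quadraticTwist d).mordellWeilRank = selmerCorankTwoInfty (W.quadraticTwist d) ∧
          Finite (W.quadraticTwist d).sha))} : ℝ) /
      Nat.card {d : ℤ | Squarefree d ∧ |d| ≤ (X : ℤ) ∧ d % 4 = 1}) atTop (𝓝 1) := by
  have hR := twistDensity_selmerCorankTwoInfty_le_one_of W hS
  have h0 : twistDensity (fun d ↦ ¬ (d ≠ 0 ∧ selmerCorankTwoInfty (W.quadraticTwist d) ≤ 1)) 0 := by
    simpa using hR.compl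
  refine tendsto_familyProportion_one_of_twistDensity_zero (h0.mono_zero fun d _ h hRd ↦ h.2 ?_)
  exact ⟨hRd.2, bsdRank_quadraticTwist_of_selmerCorankTwoInfty_le_one_of_leafOnMinimal P hPmin hleaf hGZK W hCM
    hred hW h.1 hRd.2⟩

/-- **Rank BSD for `100 %` of `d ∈ 𝓕`**, for `W` in the class `P`. [cite: arXiv250317619, Thm. 1.1 and Cor. 1.2] -/
theorem tendsto_bsdRank_of_leafOnMinimal
    (P : WeierstrassCurve ℚ → Prop)
    (hPmin : ∀ (V V' : WeierstrassCurve ℚ) [V.IsElliptic] [V.IsGloballyMinimal] [V'.IsElliptic]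
      [V'.IsGloballyMinimal] {d : ℤ}, d % 4 = 1 → ∀ {C : VariableChange ℚ}, C • V' = V.quadraticTwist (d : ℚ) →
      ¬ V.HasCM → (GoodOrd V 2 ∨ Mult V 2) → P V → P V')
    (hleaf : ∀ (V : WeierstrassCurve ℚ) [V.IsElliptic] [V.IsGloballyMinimal], ¬ V.HasCM →
      (GoodOrd V 2 ∨ Mult V 2) → P V → ∀ r : ℕ, r ≤ 1 → V.selmerCorank 2 = r → V.analyticRank = r)
    (hGZK : rank_eq_analyticRank_of_analyticRank_le_one)
    (W : WeierstrassCurve ℚ) [W.IsElliptic] [W.IsGloballyMinimal]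
    (hCM : ¬ W.HasCM) (hred : GoodOrd W 2 ∨ Mult W 2) (hW : P W)
    (hS : smith_selmerCorank_density W) :
    Tendsto (fun X : ℕ ↦ (Nat.card {d : ℤ | Squarefree d ∧ |d| ≤ (X : ℤ) ∧ (d % 4 = 1 ∧
        ((W.quadraticTwist d).analyticRank = (W.quadraticTwist d).mordellWeilRank ∧
          Finite (W.quadraticTwist d).sha))} : ℝ) /
      Nat.card {d : ℤ | Squarefree d ∧ |d| ≤ (X : ℤ) ∧ d % 4 = 1}) atTop (𝓝 1) := by
  have hR := twistDensity_selmerCorankTwoInfty_le_one_of W hS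
  have h0 : twistDensity (fun d ↦ ¬ (d ≠ 0 ∧ selmerCorankTwoInfty (W.quadraticTwist d) ≤ 1)) 0 := by
    simpa using hR.compl
  refine tendsto_familyProportion_one_of_twistDensity_zero (h0.mono_zero fun d _ h hRd ↦ h.2 ?_)
  obtain ⟨har, hrank, hsha⟩ := bsdRank_quadraticTwist_of_selmerCorankTwoInfty_le_one_of_leafOnMinimal P hPmin
    hleaf hGZK W hCM hred hW h.1 hRd.2
  exact ⟨har.trans hrank.symm, hsha⟩

/-- **Goldfeld's even half with BSD in `𝓕`**, for `W` in the class `P`. [cite: arXiv250317619, Thm. 1.1 and Cor. 1.2] [cite: MurtyMurty1997, Ch. 6 §1] -/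
theorem tendsto_familyProportion_rankZero_of_leafOnMinimal
    (P : WeierstrassCurve ℚ → Prop)
    (hPmin : ∀ (V V' : WeierstrassCurve ℚ) [V.IsElliptic] [V.IsGloballyMinimal] [V'.IsElliptic]
      [V'.IsGloballyMinimal] {d : ℤ}, d % 4 = 1 → ∀ {C : VariableChange ℚ}, C • V' = V.quadraticTwist (d : ℚ) →
      ¬ V.HasCM → (GoodOrd V 2 ∨ Mult V 2) → P V → P V')
    (hleaf : ∀ (V : WeierstrassCurve ℚ) [V.IsElliptic] [V.IsGloballyMinimal], ¬ V.HasCM →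
      (GoodOrd V 2 ∨ Mult V 2) → P V → ∀ r : ℕ, r ≤ 1 → V.selmerCorank 2 = r → V.analyticRank = r)
    (hGZK : rank_eq_analyticRank_of_analyticRank_le_one)
    (W : WeierstrassCurve ℚ) [W.IsElliptic] [W.IsGloballyMinimal]
    (hmod : exists_isNewformOf) (hCM : ¬ W.HasCM)
    (hred : GoodOrd W 2 ∨ Mult W 2) (hW : P W) (hS : smith_selmerCorank_density W) :
    Tendsto (fun X : ℕ ↦ (Nat.card {d : ℤ | Squarefree d ∧ |d| ≤ (X : ℤ) ∧ (d % 4 = 1 ∧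
        ((W.quadraticTwist d).analyticRank = 0 ∧ (W.quadraticTwist d).mordellWeilRank = 0 ∧
          Finite (W.quadraticTwist d).sha))} : ℝ) /
      Nat.card {d : ℤ | Squarefree d ∧ |d| ≤ (X : ℤ) ∧ d % 4 = 1}) atTop (𝓝 (1 / 2)) := by
  refine tendsto_familyProportion_of_congr_one (tendsto_familyProportion_rootNumber_eq_one W hmod)
    (tendsto_bsdRank_eq_selmerCorankTwoInfty_of_leafOnMinimal P hPmin hleaf hGZK W hCM hred hW hS)
    fun d hd _ hR ↦ ?_
  obtain ⟨hle, hra, hrk, hsha⟩ := hR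
  haveI := W.isElliptic_quadraticTwist (d := (d : ℚ)) (by exact_mod_cast hd.ne_zero)
  rw [rootNumber_eq_one_iff_analyticRank_eq_zero hmod _ (hra ▸ hle)]
  constructor
  · intro h0; exact ⟨h0, by rw [hrk, ← hra, h0], hsha⟩
  · exact fun h ↦ h.1

/-- **Goldfeld's odd half with BSD in `𝓕`**, for `W` in the class `P`. [cite: arXiv250317619, Thm. 1.1 and Cor. 1.2] [cite: MurtyMurty1997, Ch. 6 §1] -/
theorem tendsto_familyProportion_rankOne_of_leafOnMinimal
    (P : WeierstrassCurve ℚ → Prop)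
    (hPmin : ∀ (V V' : WeierstrassCurve ℚ) [V.IsElliptic] [V.IsGloballyMinimal] [V'.IsElliptic]
      [V'.IsGloballyMinimal] {d : ℤ}, d % 4 = 1 → ∀ {C : VariableChange ℚ}, C • V' = V.quadraticTwist (d : ℚ) →
      ¬ V.HasCM → (GoodOrd V 2 ∨ Mult V 2) → P V → P V')
    (hleaf : ∀ (V : WeierstrassCurve ℚ) [V.IsElliptic] [V.IsGloballyMinimal], ¬ V.HasCM →
      (GoodOrd V 2 ∨ Mult V 2) → P V → ∀ r : ℕ, r ≤ 1 → V.selmerCorank 2 = r → V.analyticRank = r)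
    (hGZK : rank_eq_analyticRank_of_analyticRank_le_one)
    (W : WeierstrassCurve ℚ) [W.IsElliptic] [W.IsGloballyMinimal]
    (hmod : exists_isNewformOf) (hCM : ¬ W.HasCM)
    (hred : GoodOrd W 2 ∨ Mult W 2) (hW : P W) (hS : smith_selmerCorank_density W) :
    Tendsto (fun X : ℕ ↦ (Nat.card {d : ℤ | Squarefree d ∧ |d| ≤ (X : ℤ) ∧ (d % 4 = 1 ∧
        ((W.quadraticTwist d).analyticRank = 1 ∧ (W.quadraticTwist d).mordellWeilRank = 1 ∧
          Finite (W.quadraticTwist d).sha))} : ℝ) /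
      Nat.card {d : ℤ | Squarefree d ∧ |d| ≤ (X : ℤ) ∧ d % 4 = 1}) atTop (𝓝 (1 / 2)) := by
  refine tendsto_familyProportion_of_congr_one
    (tendsto_familyProportion_rootNumber_eq_neg_one W hmod)
    (tendsto_bsdRank_eq_selmerCorankTwoInfty_of_leafOnMinimal P hPmin hleaf hGZK W hCM hred hW hS)
    fun d hd _ hR ↦ ?_
  obtain ⟨hle, hra, hrk, hsha⟩ := hR
  haveI := W.isElliptic_quadraticTwist (d := (d : ℚ)) (by exact_mod_cast hd.ne_zero)
  rw [rootNumber_eq_neg_one_iff_analyticRank_eq_one hmod _ (hra ▸ hle)]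
  constructor
  · intro h1; exact ⟨h1, by rw [hrk, ← hra, h1], hsha⟩
  · exact fun h ↦ h.1

/-- **The S3 head line for every curve of a class closed under admissible twists between minimal models, from the
leaf ON that class**: rank BSD for `100 %` of `d ∈ 𝓕` and Goldfeld's `50/50` with BSD in `𝓕`.
[cite: arXiv250317619, Thm. 1.1 and Cor. 1.2] [cite: MurtyMurty1997, Ch. 6 §1] -/
theorem bsdRank_and_goldfeld_goodTwists_of_leafOnMinimal
    (P : WeierstrassCurve ℚ → Prop)
    (hPmin : ∀ (V V' : WeierstrassCurve ℚ) [V.IsElliptic] [V.IsGloballyMinimal] [V'.IsElliptic]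
      [V'.IsGloballyMinimal] {d : ℤ}, d % 4 = 1 → ∀ {C : VariableChange ℚ}, C • V' = V.quadraticTwist (d : ℚ) →
      ¬ V.HasCM → (GoodOrd V 2 ∨ Mult V 2) → P V → P V')
    (hleaf : ∀ (V : WeierstrassCurve ℚ) [V.IsElliptic] [V.IsGloballyMinimal], ¬ V.HasCM →
      (GoodOrd V 2 ∨ Mult V 2) → P V → ∀ r : ℕ, r ≤ 1 → V.selmerCorank 2 = r → V.analyticRank = r)
    (hGZK : rank_eq_analyticRank_of_analyticRank_le_one)
    (W : WeierstrassCurve ℚ) [W.IsElliptic] [W.IsGloballyMinimal]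
    (hmod : exists_isNewformOf) (hCM : ¬ W.HasCM)
    (hred : GoodOrd W 2 ∨ Mult W 2) (hW : P W) (hS : smith_selmerCorank_density W) :
    Tendsto (fun X : ℕ ↦ (Nat.card {d : ℤ | Squarefree d ∧ |d| ≤ (X : ℤ) ∧ (d % 4 = 1 ∧
        ((W.quadraticTwist d).analyticRank = (W.quadraticTwist d).mordellWeilRank ∧
          Finite (W.quadraticTwist d).sha))} : ℝ) /
      Nat.card {d : ℤ | Squarefree d ∧ |d| ≤ (X : ℤ) ∧ d % 4 = 1}) atTop (𝓝 1) ∧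
    Tendsto (fun X : ℕ ↦ (Nat.card {d : ℤ | Squarefree d ∧ |d| ≤ (X : ℤ) ∧ (d % 4 = 1 ∧
        ((W.quadraticTwist d).analyticRank = 0 ∧ (W.quadraticTwist d).mordellWeilRank = 0 ∧
          Finite (W.quadraticTwist d).sha))} : ℝ) /
      Nat.card {d : ℤ | Squarefree d ∧ |d| ≤ (X : ℤ) ∧ d % 4 = 1}) atTop (𝓝 (1 / 2)) ∧
    Tendsto (fun X : ℕ ↦ (Nat.card {d : ℤ | Squarefree d ∧ |d| ≤ (X : ℤ) ∧ (d % 4 = 1 ∧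
        ((W.quadraticTwist d).analyticRank = 1 ∧ (W.quadraticTwist d).mordellWeilRank = 1 ∧
          Finite (W.quadraticTwist d).sha))} : ℝ) /
      Nat.card {d : ℤ | Squarefree d ∧ |d| ≤ (X : ℤ) ∧ d % 4 = 1}) atTop (𝓝 (1 / 2)) :=
  ⟨tendsto_bsdRank_of_leafOnMinimal P hPmin hleaf hGZK W hCM hred hW hS,
    tendsto_familyProportion_rankZero_of_leafOnMinimal P hPmin hleaf hGZK W hmod hCM hred hW hS,
    tendsto_familyProportion_rankOne_of_leafOnMinimal P hPmin hleaf hGZK W hmod hCM hred hW hS⟩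

end Density

end Summit.BirchSwinnertonDyer.BirchSwinnertonDyer.Theorems.TwoAdicOffHabitat

end
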